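import Summits.AnomalousDissipation.AnomalousDissipation.Theorems.SawtoothPulseCascadeK1LocalisedCascadePhaseOneL1Eval

/-!
# K1loc explicit start, phase 1 — helper: GROUPED `ℓ¹` AND ENERGY EVALUATION OF AN H-FIBRE OF `a₁` («PhaseOneGroupEval»)

Helper file of the prover lane on the crux `K1LocalisedCascade` (stmt-AnomalousDissipation-19491), route `SawtoothPulseCascade`
(arbiter A24-6 steps (3)–(5): the per-H-fibre certificates of the V/O junk take, for each fibre `n` of `a₁`, the `ℓ¹` norms of the source
GROUPS `Q′ < |q| ≤ Q` and the fibre energy over `1 ≤ |q| ≤ 100`).  As `…PhaseOneL1Eval.phaseOne_L1_le_eval`, from the rational table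
`…PhaseOneAmplitude.phaseOne_amplitude_le_rat` (`Ā(n,−q) = Ā(n,q)`, `…PhaseOneHFibre.abar_neg`):
* `sum_srcGroup_eq_sum_range`: `Σ_{q ∈ S_Q, Q′ < |q| ≤ Q″} f q = Σ_{i < Q″−Q′} (f(Q′+1+i) + f(−(Q′+1+i)))` (`Q″ ≤ Q`);
* `phaseOne_group_le_eval`: `Σ_{i<Q″−Q′} 2Ā(n, Q′+1+i) ≤ v ⇒ Σ_{q∈S_Q, Q′<|q|≤Q″} ‖𝓕a₁(n,q)‖ ≤ v`;
* `phaseOne_energy_le_eval`: `Σ_{i<Q} 2Ā(n, i+1)² ≤ e ⇒ Σ_{q∈S_Q} ‖𝓕a₁(n,q)‖² ≤ e`.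
No definitions; nothing about the crux. [cite: Grafakos2014, Prop. 3.2.7 (3)] [problem: turb]
-/

-- `Summit.<Summit>.<Problem>`: single-conjunct summit, the duplicate namespace segment is deliberate.
set_option linter.dupNamespace false

noncomputable section

namespace Summit.AnomalousDissipation.AnomalousDissipation.Theorems.SawtoothPulseCascade.K1Start

open MeasureTheory Filter Topology UnitAddTorus Complex AddCircle
open scoped Real
open Literature.Analysis Literature.Analysis.FunctionSpaces Literature.Analysis.FunctionSpaces.Torus Literature.Analysis.FluidPDE
open Literature.Analysis.FluidPDE.ShearStage
open Literature.Analysis.FluidPDE.SawtoothCascade Literature.Analysis.FluidPDE.SawtoothCascade.CascadeParams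
open Summit.AnomalousDissipation.AnomalousDissipation.Theorems.SawtoothPulseCascade.K1Window

/-! ## §1 The source groups -/

/-- `Σ_{q ∈ S_Q, Q′ < |q| ≤ Q″} f q = Σ_{i<Q″−Q′} (f(Q′+1+i) + f(−(Q′+1+i)))` for `Q′ ≤ Q″ ≤ Q`. [folklore] -/
theorem sum_srcGroup_eq_sum_range (f : ℤ → ℝ) {Q Q' Q'' : ℕ} (h1 : Q' ≤ Q'') (h2 : Q'' ≤ Q) :
    ∑ q ∈ ((Finset.Icc (-(Q : ℤ)) Q).filter (fun q => 1 ≤ |q|)).filter (fun q => (Q' : ℤ) < |q| ∧ |q| ≤ Q''), f q =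
      ∑ i ∈ Finset.range (Q'' - Q'), (f ((Q' : ℤ) + 1 + i) + f (-((Q' : ℤ) + 1 + i))) := by
  classical
  have hsplit : ((Finset.Icc (-(Q : ℤ)) Q).filter (fun q => 1 ≤ |q|)).filter (fun q => (Q' : ℤ) < |q| ∧ |q| ≤ Q'') =
      Finset.Ioc (Q' : ℤ) Q'' ∪ (Finset.Ioc (Q' : ℤ) Q'').image (fun q => -q) := by
    ext q
    rw [Finset.mem_filter, Finset.mem_filter, Finset.mem_Icc, Finset.mem_union, Finset.mem_Ioc, Finset.mem_image]
    have hQ : (Q'' : ℤ) ≤ Q := by exact_mod_cast h2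
    constructor
    · rintro ⟨⟨_, _⟩, h3, h4⟩
      rcases le_or_gt 0 q with h | h
      · left; rw [abs_of_nonneg h] at h3 h4; exact ⟨h3, h4⟩
      · right; refine ⟨-q, Finset.mem_Ioc.2 ?_, by ring⟩; rw [abs_of_neg h] at h3 h4; exact ⟨h3, h4⟩
    · rintro (⟨h3, h4⟩ | ⟨m, hm, rfl⟩)
      · have h0 : 0 ≤ q := by have := Nat.cast_nonneg (α := ℤ) Q'; omega
        rw [abs_of_nonneg h0]; exact ⟨⟨⟨by omega, by omega⟩, by omega⟩, h3, h4⟩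
      · rw [Finset.mem_Ioc] at hm
        have h0 : 0 < m := by have := Nat.cast_nonneg (α := ℤ) Q'; omega
        rw [abs_neg, abs_of_pos h0]; exact ⟨⟨⟨by omega, by omega⟩, by omega⟩, hm.1, hm.2⟩
  have hdisj : Disjoint (Finset.Ioc (Q' : ℤ) Q'') ((Finset.Ioc (Q' : ℤ) Q'').image (fun q => -q)) := by
    rw [Finset.disjoint_left]; intro q hq hq'
    rw [Finset.mem_Ioc] at hq; rw [Finset.mem_image] at hq'
    obtain ⟨m, hm, rfl⟩ := hq'; rw [Finset.mem_Ioc] at hm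
    have := Nat.cast_nonneg (α := ℤ) Q'; omega
  rw [hsplit, Finset.sum_union hdisj, Finset.sum_image fun a _ b _ h => by simpa using h,
    sum_Ioc_eq_sum_range _ h1, Finset.sum_add_distrib]
  congr 1
  rw [sum_Ioc_eq_sum_range _ h1]

section Cascade

variable (P : CascadeParams)

/-! ## §2 The grouped `ℓ¹` evaluation and the energy evaluation -/

/-- **Grouped `ℓ¹` evaluation of a phase-1 H-fibre**: for `Q′ ≤ Q″ ≤ Q`, if `Σ_{i<Q″−Q′} 2·Ā(n, Q′+1+i) ≤ v` then
`Σ_{q ∈ S_Q, Q′ < |q| ≤ Q″} ‖𝓕a₁(n,q)‖ ≤ v`. [cite: Grafakos2014, Prop. 3.2.7 (3)] -/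
theorem phaseOne_group_le_eval (hγ : P.γ = 8) (hN₀ : P.N₀ = 1) (hδ₀ : 0 < P.δ₀) (hδ₀' : P.δ₀ ≤ (2 : ℝ)⁻¹ ^ 30) (hd : 0 < P.d)
    (a b : ℕ → UnitAddTorus (Fin 2) → ℝ) (h0 : a 0 = datum)
    (hb : b 0 = a 0 ∘ shearMap 0 1 (amp ⟨P.U 0, P.U_periodic 0, P.contDiff_U (P.δ_pos hδ₀ hd 0)⟩ P.γ))
    (hab : a 1 = b 0 ∘ shearMap 1 0 (amp ⟨P.U 0, P.U_periodic 0, P.contDiff_U (P.δ_pos hδ₀ hd 0)⟩ P.γ))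
    (n : ℤ) {Q Q' Q'' : ℕ} (h1 : Q' ≤ Q'') (h2 : Q'' ≤ Q) {v : ℝ}
    (hv : ∑ i ∈ Finset.range (Q'' - Q'), 2 * (1 / 2 * ((if ((Q' : ℤ) + 1 + i) = 8 ∨ ((Q' : ℤ) + 1 + i) = -8 then (1 / 2 : ℝ)
          else if ((Q' : ℤ) + 1 + i) % 2 = 0 then 0 else 16 * 0.31831 / |64 - ((((Q' : ℤ) + 1 + i : ℤ)) : ℝ) ^ 2|) + (2 : ℝ)⁻¹ ^ 25) *
        ((if 8 * ((Q' : ℤ) + 1 + i) + (n + 1) = 0 ∨ 8 * ((Q' : ℤ) + 1 + i) - (n + 1) = 0 then (1 / 2 : ℝ) else if (n + 1) % 2 = 0 then 0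
            else 16 * |((((Q' : ℤ) + 1 + i : ℤ)) : ℝ)| * 0.31831 / |64 * ((((Q' : ℤ) + 1 + i : ℤ)) : ℝ) ^ 2 - ((n + 1 : ℤ) : ℝ) ^ 2|) +
          (if 8 * ((Q' : ℤ) + 1 + i) + (n - 1) = 0 ∨ 8 * ((Q' : ℤ) + 1 + i) - (n - 1) = 0 then (1 / 2 : ℝ) else if (n - 1) % 2 = 0 then 0
            else 16 * |((((Q' : ℤ) + 1 + i : ℤ)) : ℝ)| * 0.31831 / |64 * ((((Q' : ℤ) + 1 + i : ℤ)) : ℝ) ^ 2 - ((n - 1 : ℤ) : ℝ) ^ 2|) +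
          2 * |((((Q' : ℤ) + 1 + i : ℤ)) : ℝ)| * (2 : ℝ)⁻¹ ^ 25)) ≤ v) :
    ∑ q ∈ ((Finset.Icc (-(Q : ℤ)) Q).filter (fun q => 1 ≤ |q|)).filter (fun q => (Q' : ℤ) < |q| ∧ |q| ≤ Q''),
      ‖mFourierCoeff (fun x => (a 1 x : ℂ)) ![n, q]‖ ≤ v := by
  rw [sum_srcGroup_eq_sum_range _ h1 h2]
  refine le_trans (Finset.sum_le_sum fun i _ => ?_) hv
  have hq1 : ((Q' : ℤ) + 1 + i) ≠ 0 := by have := Nat.cast_nonneg (α := ℤ) Q'; omega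
  have hq2 : (-((Q' : ℤ) + 1 + i)) ≠ 0 := by have := Nat.cast_nonneg (α := ℤ) Q'; omega
  have e1 := phaseOne_amplitude_le_rat P hγ hN₀ hδ₀ hδ₀' hd a b h0 hb hab n hq1
  have e2 := phaseOne_amplitude_le_rat P hγ hN₀ hδ₀ hδ₀' hd a b h0 hb hab n hq2
  rw [abar_neg n ((Q' : ℤ) + 1 + i)] at e2
  linarith

/-- **Energy evaluation of a phase-1 H-fibre**: if `Σ_{i<Q} 2·Ā(n, i+1)² ≤ e` then `Σ_{q ∈ S_Q} ‖𝓕a₁(n,q)‖² ≤ e`.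
[cite: Grafakos2014, Prop. 3.2.7 (3)] -/
theorem phaseOne_energy_le_eval (hγ : P.γ = 8) (hN₀ : P.N₀ = 1) (hδ₀ : 0 < P.δ₀) (hδ₀' : P.δ₀ ≤ (2 : ℝ)⁻¹ ^ 30) (hd : 0 < P.d)
    (a b : ℕ → UnitAddTorus (Fin 2) → ℝ) (h0 : a 0 = datum)
    (hb : b 0 = a 0 ∘ shearMap 0 1 (amp ⟨P.U 0, P.U_periodic 0, P.contDiff_U (P.δ_pos hδ₀ hd 0)⟩ P.γ))
    (hab : a 1 = b 0 ∘ shearMap 1 0 (amp ⟨P.U 0, P.U_periodic 0, P.contDiff_U (P.δ_pos hδ₀ hd 0)⟩ P.γ))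
    (n : ℤ) (Q : ℕ) {e : ℝ}
    (he : ∑ i ∈ Finset.range Q, 2 * (1 / 2 * ((if ((i : ℤ) + 1) = 8 ∨ ((i : ℤ) + 1) = -8 then (1 / 2 : ℝ)
          else if ((i : ℤ) + 1) % 2 = 0 then 0 else 16 * 0.31831 / |64 - ((((i : ℤ) + 1 : ℤ)) : ℝ) ^ 2|) + (2 : ℝ)⁻¹ ^ 25) *
        ((if 8 * ((i : ℤ) + 1) + (n + 1) = 0 ∨ 8 * ((i : ℤ) + 1) - (n + 1) = 0 then (1 / 2 : ℝ) else if (n + 1) % 2 = 0 then 0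
            else 16 * |((((i : ℤ) + 1 : ℤ)) : ℝ)| * 0.31831 / |64 * ((((i : ℤ) + 1 : ℤ)) : ℝ) ^ 2 - ((n + 1 : ℤ) : ℝ) ^ 2|) +
          (if 8 * ((i : ℤ) + 1) + (n - 1) = 0 ∨ 8 * ((i : ℤ) + 1) - (n - 1) = 0 then (1 / 2 : ℝ) else if (n - 1) % 2 = 0 then 0
            else 16 * |((((i : ℤ) + 1 : ℤ)) : ℝ)| * 0.31831 / |64 * ((((i : ℤ) + 1 : ℤ)) : ℝ) ^ 2 - ((n - 1 : ℤ) : ℝ) ^ 2|) +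
          2 * |((((i : ℤ) + 1 : ℤ)) : ℝ)| * (2 : ℝ)⁻¹ ^ 25)) ^ 2 ≤ e) :
    ∑ q ∈ (Finset.Icc (-(Q : ℤ)) Q).filter (fun q => 1 ≤ |q|), ‖mFourierCoeff (fun x => (a 1 x : ℂ)) ![n, q]‖ ^ 2 ≤ e := by
  rw [sum_srcSet_eq_sum_range]
  refine le_trans (Finset.sum_le_sum fun i _ => ?_) he
  have hq1 : ((i : ℤ) + 1) ≠ 0 := by omega
  have hq2 : (-((i : ℤ) + 1)) ≠ 0 := by omega
  have e1 := phaseOne_amplitude_le_rat P hγ hN₀ hδ₀ hδ₀' hd a b h0 hb hab n hq1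
  have e2 := phaseOne_amplitude_le_rat P hγ hN₀ hδ₀ hδ₀' hd a b h0 hb hab n hq2
  rw [abar_neg n ((i : ℤ) + 1)] at e2
  have h0 : 0 ≤ ‖mFourierCoeff (fun x => (a 1 x : ℂ)) ![n, (i : ℤ) + 1]‖ := norm_nonneg _
  have h0' : 0 ≤ ‖mFourierCoeff (fun x => (a 1 x : ℂ)) ![n, -((i : ℤ) + 1)]‖ := norm_nonneg _
  have s1 := pow_le_pow_left₀ h0 e1 2
  have s2 := pow_le_pow_left₀ h0' e2 2
  linarith

end Cascade

end Summit.AnomalousDissipation.AnomalousDissipation.Theorems.SawtoothPulseCascade.K1Start
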